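import Mathlib
import Summits.MatrixMultiplication.MatrixMultiplication.Theses.SnSubsetDichotomy
import Literature.RepresentationTheory.FiniteGroups.KLRGradedCellularBasis
import Summits.MatrixMultiplication.MatrixMultiplication.Theorems.SnSubsetDichotomyNoThresholdSubsetTriplePairWindow
import Summits.MatrixMultiplication.MatrixMultiplication.Theorems.SnSubsetDichotomyNoThresholdSubsetTripleBlockCentering

/-!
# Line `one-point-chernoff` — crux `NoThresholdSubsetTriple` (stmt-MatrixMultiplication-8302) — ALTERNATIVE skeleton (strategist)

Registered by the crux-strategist (cstrat-stmt-MatrixMultiplication-8302-s1, 2026-08-17) as an ALTERNATIVE line: its stubs are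
added with `workitem stub-add` next to the live skeleton `Lines/klr_graded_polynomial_method.lean` (lead c6), which is untouched.

THE POINT. The KLR graded polynomial method (K3 = `KLRGradedCellularBasis` + K1 graded codimension + slice-rank transfer, all in
the tree) needs ONE probabilistic input about the Brundan–Kleshchev–Wang 2-degree `X = deg₂S + deg₂T` of a uniformly random
same-shape tableau pair against the 2-weight `w` of its block. The tree records it in five interchangeable forms (J′ p130059,
WINDOW p133699, DEV/MGF/MOMENTS p134410, shape-split p136552). This line files the MINIMAL exponential-moment form — the
ONE-POINT CHERNOFF FUNCTIONAL, i.e. literally the `ρ₂(n)` statistic of the card `klr-graded-codimension` whose exact values are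
known to `n = 84` (`−log ρ₂(n)/√n = 0.0217 → 0.0220`, non-decreasing from `n = 30`):

  (C1)  `∃ θ > 0, c > 0: ∑_{(μ,S,T) ⊢ n} exp(θ·(2w/3 − X)/√n) ≤ n!·e^{-c√n}` for all large `n`

— one tilt, one inequality, a LINEAR margin (`(1/√n)·log E e^{-θ(X−w)/√n} < θ/6`), no uniformity in `θ`, no quadratic shape,
no centring. By Markov (indicator ≤ exponential) and the block palindromy `#{content α, X−w = d} = #{content α, X−w = −d}`
(tree theorem `card_degree_sub_weight_symm`, p136294) it gives the WINDOW count, hence the crux through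
`noThresholdSubsetTriple_of_klr_pairWindow` (p133699). Logical position: MGF-form ⇒ (C1) ⇒ WINDOW; (C1) is strictly weaker than
MGF/MOMENTS and incomparable with DEV/J′ (it needs a linear far lower tail of `X − w` at speed `√n`, which DEV does not, and no
two-sidedness, which DEV does). Numerics (strategist, exact, `compute/lyapunov_probe.py`): at `n = 30`,
`(1/√n) log[(1/n!)∑ e^{-a(X−2w/3)/√n}] = −0.0121 (a = 0.1), −0.0207 (a = 0.3), +0.006 (a = 0.6)`; Gaussian prediction
`0.26a² − a/6`; the optimum `a ≈ 0.3` reproduces the known `0.021`.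

WHAT IT DOES NOT DO: it does not dodge the core. Every sufficient form funnels into the same content — exponential integrability of
`(X − w)/√n` at one positive parameter, uniformly in `n` (Cramér regime over ≈ 2.2√n relaxation periods of the Plancherel growth;
lead-c5 §2e) — and two strategist probes of would-be shortcuts are NEGATIVE and recorded in the line card: (i) the Laplace
transform `E exp(ζ(X−w)/√n)` has complex zeros at `|ζ| ≈ 6` (flat over `11 ≤ n ≤ 38`), so a zero-free disc exists only at the
MGF scale and Borel–Carathéodory still needs a one-point bound like (C1); (ii) the weighted-Schur / Lyapunov supersolution bound
for `‖G^n∅‖²` (`G` = the tilted box-adding operator, `(C1) ⟺ ‖G^n∅‖² ≤ n!e^{-c√n}`) with `Φ ≡ 1` or a charge penalty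
`e^{κ d²/√k}` FAILS (`sup_λ' E_cotr[g²] ≫` typical: `(1/√n) log bound = +0.7 … +8` at `n = 30`), so any supersolution must encode
the fixed-shape tilted moments `E_λ[q^{deg T}]` — i.e. lead c6's (U) ∧ (D).

Stubs: K3 `stub_klrGradedBasis` (shared with the live line, same signature; fact debt), (C1) `stub_onePointChernoff` (OPEN,
hardest), bridge `stub_window_of_onePointChernoff` (provable now, M: Markov + p136294). Composition kernel-checked below.

DISPROOF USED (Cruxes/NoThresholdSubsetTriple/Disproof.lean v8): `false_without_TPP`, `false_with_pairwise_only` live inside the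
transfer p97404 (genuine three-fold TPP via `sq_le_sliceRank_of_realizesTPP`); `holds_without_posConst`: `c > 0` comes from (C1)'s
`c` (halved in the bridge and the transfer); `false_without_n0`: `n₀` from (C1); `crux_holds_for_young_triples`: consistent; §9
targets only the dead Loewy line; no `Negative/` lemma exists for this crux.
-/

set_option linter.dupNamespace false

noncomputable section

open scoped BigOperators

namespace Summit.MatrixMultiplication.MatrixMultiplication.Cruxes.NoThresholdSubsetTriple.OnePointChernoff

/-- **K3 — the KLR graded cellular basis** (Literature named fact `KLRGradedCellularBasis`, reviewed p98108; Brundan–Kleshchev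
2009 Main Theorem + Hu–Mathas 2010 Main Theorem + Brundan–Kleshchev–Wang 2011 §3). Shared verbatim with the live line's
registered stub of the same name; discharged only by formalising BK09 + HM10 (XL). -/
theorem stub_klrGradedBasis : Literature.RepresentationTheory.FiniteGroups.KLRGradedCellularBasis := by
  sorry

/-- **(C1) — THE ONE-POINT CHERNOFF FUNCTIONAL (the open heart of this line).** For some tilt `θ > 0`, some `c > 0` and all
large `n`: `∑_{i : TableauPair n} exp(θ·((2/3)·w_i − X_i)/√n) ≤ n!·e^{-c√n}`, where `X_i = TableauPair.degree 2 i = deg₂S + deg₂T`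
and `w_i = c₀ − (c₀ − c₁)²` is the 2-weight (defect) of the block of the shape (`c_j = TableauPair.content 2 i j`). Equivalently
`(1/√n)·log E[e^{-θ(X−w)/√n}] ≤ θ/6 − c − o(1)` for a uniform random pair: exponential integrability of `(X−w)/√n` at ONE negative
parameter with a linear margin. It is `ρ₂(n) ≤ e^{-c√n}` for the Chernoff functional of card `klr-graded-codimension` (exact:
`−log ρ₂(n)/√n = 0.0217…0.0220` for `30 ≤ n ≤ 84`, seat −1 `klr_dp_n64.txt` + j016421). Gaussian heuristic: `0.26θ² − θ/6 < 0`
for `θ < 0.64`. WHY OPEN: a speed-√n Cramér-regime bound for an additive functional of Plancherel growth with relaxation time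
`0.28√n` (lead-c5 §2e); no theorem in print. [difficulty: open-problem] -/
theorem stub_onePointChernoff :
    ∃ θ : ℝ, 0 < θ ∧ ∃ c : ℝ, 0 < c ∧ ∃ n₀ : ℕ, ∀ n ≥ n₀, ∑ i : Literature.RepresentationTheory.FiniteGroups.TableauPair n, Real.exp (θ * ((2 / 3 : ℝ) * (((Literature.RepresentationTheory.FiniteGroups.TableauPair.content 2 i 0 : ℤ) - ((Literature.RepresentationTheory.FiniteGroups.TableauPair.content 2 i 0 : ℤ) - (Literature.RepresentationTheory.FiniteGroups.TableauPair.content 2 i 1 : ℤ)) ^ 2) : ℝ) - (Literature.RepresentationTheory.FiniteGroups.TableauPair.degree 2 i : ℝ)) / Real.sqrt (n : ℝ)) ≤ (n.factorial : ℝ) * Real.exp (-(c * Real.sqrt (n : ℝ))) := by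
  sorry

/-- **Bridge — (C1) ⟹ WINDOW** (provable now, M). With `a_i = ⌊(2w_i+2)/3⌋` the cut of `noThresholdSubsetTriple_of_klr_pairWindow`:
`#{X < a} ≤ ∑ e^{θ(a−X)/√n} ≤ e^{2θ/√n}∑ e^{θ((2/3)w − X)/√n}` (indicator ≤ exponential, `a ≤ (2/3)w + 2`), and for the upper term
`#{2a ≤ X} ≤ ∑ e^{θ(X−2a)/√n} = ∑ e^{θ(2w−2a−X')/√n}` after the block involution `X − w ↦ w − X` (tree theorem
`card_degree_sub_weight_symm`, p136294, applied value by value inside each content class), and `2w − 2a ≤ (2/3)w`; so the window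
count is `≤ 3e^{2θ/√n}·n!·e^{-c√n} ≤ n!·e^{-(c/2)√n}` for large `n`. [difficulty: M] -/
theorem stub_window_of_onePointChernoff :
    (∃ θ : ℝ, 0 < θ ∧ ∃ c : ℝ, 0 < c ∧ ∃ n₀ : ℕ, ∀ n ≥ n₀, ∑ i : Literature.RepresentationTheory.FiniteGroups.TableauPair n, Real.exp (θ * ((2 / 3 : ℝ) * (((Literature.RepresentationTheory.FiniteGroups.TableauPair.content 2 i 0 : ℤ) - ((Literature.RepresentationTheory.FiniteGroups.TableauPair.content 2 i 0 : ℤ) - (Literature.RepresentationTheory.FiniteGroups.TableauPair.content 2 i 1 : ℤ)) ^ 2) : ℝ) - (Literature.RepresentationTheory.FiniteGroups.TableauPair.degree 2 i : ℝ)) / Real.sqrt (n : ℝ)) ≤ (n.factorial : ℝ) * Real.exp (-(c * Real.sqrt (n : ℝ)))) →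
    (∃ c : ℝ, 0 < c ∧ ∃ n₀ : ℕ, ∀ n ≥ n₀, ((2 * Nat.card {i : Literature.RepresentationTheory.FiniteGroups.TableauPair n // Literature.RepresentationTheory.FiniteGroups.TableauPair.degree 2 i < (2 * ((Literature.RepresentationTheory.FiniteGroups.TableauPair.content 2 i 0 : ℤ) - ((Literature.RepresentationTheory.FiniteGroups.TableauPair.content 2 i 0 : ℤ) - (Literature.RepresentationTheory.FiniteGroups.TableauPair.content 2 i 1 : ℤ)) ^ 2) + 2) / 3} + Nat.card {i : Literature.RepresentationTheory.FiniteGroups.TableauPair n // 2 * ((2 * ((Literature.RepresentationTheory.FiniteGroups.TableauPair.content 2 i 0 : ℤ) - ((Literature.RepresentationTheory.FiniteGroups.TableauPair.content 2 i 0 : ℤ) - (Literature.RepresentationTheory.FiniteGroups.TableauPair.content 2 i 1 : ℤ)) ^ 2) + 2) / 3) ≤ Literature.RepresentationTheory.FiniteGroups.TableauPair.degree 2 i} : ℕ) : ℝ) ≤ (n.factorial : ℝ) * Real.exp (-(c * Real.sqrt (n : ℝ)))) := by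
  sorry

/-! ## Composition (kernel-checked, no sorry of its own): the stubs imply the crux BY NAME -/

/-- `K3 ∧ (C1) ⟹ NoThresholdSubsetTriple`, through the bridge and the tree theorem `noThresholdSubsetTriple_of_klr_pairWindow`
(p133699 = K1 graded codimension p97461 + slice-rank transfer p97404). -/
theorem NoThresholdSubsetTriple_of :
    Summit.MatrixMultiplication.MatrixMultiplication.Theses.SnSubsetDichotomy.NoThresholdSubsetTriple :=
  Summit.MatrixMultiplication.MatrixMultiplication.Theorems.noThresholdSubsetTriple_of_klr_pairWindow
    stub_klrGradedBasis (stub_window_of_onePointChernoff stub_onePointChernoff)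

end Summit.MatrixMultiplication.MatrixMultiplication.Cruxes.NoThresholdSubsetTriple.OnePointChernoff

end
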